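import Mathlib

/-! # (A₄) MATCH₄, algebraic half (E): the HOMOGENEOUS GAP EXPANSION (decomp-kz lens-1 g13, RUNG4_sec22 §23)

Every `P ∈ ℚ[t₀,t₁,t₂,t₃]` is, as a function on `ℝ⁴`, a ℚ-combination of 5-gap monomials `g^κ` ALL OF THE SAME TOTAL DEGREE `d`
(`g₀ = 1 - t₀, g₁ = t₀ - t₁, g₂ = t₁ - t₂, g₃ = t₂ - t₃, g₄ = t₃`, `Σ gᵢ = 1`):  `P(t) = Σ_{|κ| = d} c_κ ∏ gᵢ(t)^{κᵢ}`.
Construction: substitute `t_j = g_{j+1} + ⋯ + g₄` (`tailSub`), then multiply the degree-`j` homogeneous component by `(Σ gᵢ)^{d-j} = 1`.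
In this basis the cluster criterion for `P/Q` on `Δ₄` is decided TERMWISE (§23(4)): `ord_G P = min {deg_G κ : c_κ ≠ 0}`. -/

set_option linter.dupNamespace false
set_option linter.unusedSimpArgs false

namespace Summit.KontsevichZagierPeriods.KontsevichZagierPeriods.Cruxes.GZNormalFormWThree.GZLadder.GapExpand

open MvPolynomial Finset

/-- the five gaps of `t ∈ ℝ⁴`: `(1 - t₀, t₀ - t₁, t₁ - t₂, t₂ - t₃, t₃)` -/
def gaps (t : Fin 4 → ℝ) : Fin 5 → ℝ := ![1 - t 0, t 0 - t 1, t 1 - t 2, t 2 - t 3, t 3]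

/-- Auxiliary step `gaps_zero`: gaps zero. [bookkeeping] -/
theorem gaps_zero (t : Fin 4 → ℝ) : gaps t 0 = 1 - t 0 := rfl
/-- Auxiliary step `gaps_one`: gaps one. [bookkeeping] -/
theorem gaps_one (t : Fin 4 → ℝ) : gaps t 1 = t 0 - t 1 := rfl
/-- Auxiliary step `gaps_two`: gaps two. [bookkeeping] -/
theorem gaps_two (t : Fin 4 → ℝ) : gaps t 2 = t 1 - t 2 := rfl
/-- Auxiliary step `gaps_three`: gaps three. [bookkeeping] -/
theorem gaps_three (t : Fin 4 → ℝ) : gaps t 3 = t 2 - t 3 := rfl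
/-- Auxiliary step `gaps_four`: gaps four. [bookkeeping] -/
theorem gaps_four (t : Fin 4 → ℝ) : gaps t 4 = t 3 := rfl

/-- the gaps sum to `1` -/
theorem sum_gaps (t : Fin 4 → ℝ) : ∑ i, gaps t i = 1 := by
  simp only [Fin.sum_univ_five, gaps_zero, gaps_one, gaps_two, gaps_three, gaps_four]
  ring

/-- `t_j = g_{j+1} + ⋯ + g₄` as polynomials in the gap variables -/
noncomputable def tail : Fin 4 → MvPolynomial (Fin 5) ℚ :=
  ![X 1 + X 2 + X 3 + X 4, X 2 + X 3 + X 4, X 3 + X 4, X 4]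

/-- Auxiliary step `aeval_gaps_tail`: aeval gaps tail. [bookkeeping] -/
theorem aeval_gaps_tail (t : Fin 4 → ℝ) (j : Fin 4) : aeval (gaps t) (tail j) = t j := by
  fin_cases j <;> simp [tail, gaps_zero, gaps_one, gaps_two, gaps_three, gaps_four]

/-- the substitution `P(t) ↦ P(g₁+⋯+g₄, g₂+g₃+g₄, g₃+g₄, g₄)` -/
noncomputable def tailSub : MvPolynomial (Fin 4) ℚ →ₐ[ℚ] MvPolynomial (Fin 5) ℚ := bind₁ tail

/-- Auxiliary step `aeval_gaps_tailSub`: aeval gaps tail Sub. [bookkeeping] -/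
theorem aeval_gaps_tailSub (t : Fin 4 → ℝ) (P : MvPolynomial (Fin 4) ℚ) : aeval (gaps t) (tailSub P) = aeval t P := by
  have e : (fun j => aeval (gaps t) (tail j)) = t := funext (aeval_gaps_tail t)
  rw [tailSub, aeval_bind₁, e]

/-- homogenisation to degree `d`: multiply the degree-`j` component by `(Σ gᵢ)^{d-j}` -/
noncomputable def homog (d : ℕ) (R : MvPolynomial (Fin 5) ℚ) : MvPolynomial (Fin 5) ℚ :=
  ∑ j ∈ range (d + 1), (∑ i : Fin 5, X i) ^ (d - j) * homogeneousComponent j R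

/-- Auxiliary step `isHomogeneous_sumX`: is Homogeneous sum X. [bookkeeping] -/
theorem isHomogeneous_sumX : ((∑ i : Fin 5, X i : MvPolynomial (Fin 5) ℚ)).IsHomogeneous 1 :=
  IsHomogeneous.sum _ _ _ fun i _ => isHomogeneous_X ℚ i

/-- Auxiliary step `homog_isHomogeneous`: homog is Homogeneous. [bookkeeping] -/
theorem homog_isHomogeneous (d : ℕ) (R : MvPolynomial (Fin 5) ℚ) : (homog d R).IsHomogeneous d := by
  apply IsHomogeneous.sum
  intro j hj
  have hjd : j ≤ d := Nat.lt_succ_iff.mp (mem_range.mp hj)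
  have h := (isHomogeneous_sumX.pow (d - j)).mul (homogeneousComponent_isHomogeneous j R)
  have e : 1 * (d - j) + j = d := by omega
  rw [e] at h
  exact h

/-- Auxiliary step `sum_homogeneousComponent_of_le`: sum homogeneous Component of le. [bookkeeping] -/
theorem sum_homogeneousComponent_of_le (d : ℕ) (R : MvPolynomial (Fin 5) ℚ) (hd : R.totalDegree ≤ d) :
    ∑ j ∈ range (d + 1), homogeneousComponent j R = R := by
  rw [← Finset.sum_range_add_sum_Ico _ (show R.totalDegree + 1 ≤ d + 1 by omega), sum_homogeneousComponent,
    Finset.sum_eq_zero fun j hj => ?_, add_zero]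
  exact homogeneousComponent_eq_zero j R (by have := (Finset.mem_Ico.mp hj).1; omega)

/-- Auxiliary step `aeval_gaps_homog`: aeval gaps homog. [bookkeeping] -/
theorem aeval_gaps_homog (t : Fin 4 → ℝ) (d : ℕ) (R : MvPolynomial (Fin 5) ℚ) (hd : R.totalDegree ≤ d) :
    aeval (gaps t) (homog d R) = aeval (gaps t) R := by
  have h1 : aeval (gaps t) (∑ i : Fin 5, X i : MvPolynomial (Fin 5) ℚ) = 1 := by
    rw [map_sum]
    simp only [aeval_X]
    exact sum_gaps t
  conv_rhs => rw [← sum_homogeneousComponent_of_le d R hd]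
  simp only [homog, map_sum, map_mul, map_pow, h1, one_pow, one_mul]

/-- **THE HOMOGENEOUS GAP EXPANSION.** For every `P ∈ ℚ[t₀..t₃]` there is a homogeneous `R ∈ ℚ[g₀..g₄]` (degree
`d = deg P(g)`) with `P(t) = R(gaps t)` on all of `ℝ⁴`. -/
theorem exists_homogeneous_gaps (P : MvPolynomial (Fin 4) ℚ) :
    ∃ (d : ℕ) (R : MvPolynomial (Fin 5) ℚ), R.IsHomogeneous d ∧ ∀ t : Fin 4 → ℝ, aeval (gaps t) R = aeval t P :=
  ⟨(tailSub P).totalDegree, homog _ (tailSub P), homog_isHomogeneous _ _, fun t => by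
    rw [aeval_gaps_homog t _ _ le_rfl, aeval_gaps_tailSub]⟩

/-- evaluation of a gap polynomial as an explicit sum of monomials -/
theorem aeval_gaps_eq_sum (t : Fin 4 → ℝ) (R : MvPolynomial (Fin 5) ℚ) :
    aeval (gaps t) R = ∑ κ ∈ R.support, ((coeff κ R : ℚ) : ℝ) * ∏ i, gaps t i ^ κ i := by
  rw [MvPolynomial.aeval_def, MvPolynomial.eval₂_eq']
  simp only [eq_ratCast]

/-- **MATCH₄ (E), pointwise form.** `P(t) = Σ_{κ ∈ S} c_κ (1-t₀)^κ₀ (t₀-t₁)^κ₁ (t₁-t₂)^κ₂ (t₂-t₃)^κ₃ t₃^κ₄` with ALL `|κ| = d`. -/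
theorem gapExpand (P : MvPolynomial (Fin 4) ℚ) :
    ∃ (d : ℕ) (S : Finset (Fin 5 →₀ ℕ)) (c : (Fin 5 →₀ ℕ) → ℚ),
      (∀ κ ∈ S, ∑ i, κ i = d) ∧
      ∀ t : Fin 4 → ℝ, aeval t P =
        ∑ κ ∈ S, (c κ : ℝ) * ((1 - t 0) ^ κ 0 * (t 0 - t 1) ^ κ 1 * (t 1 - t 2) ^ κ 2 * (t 2 - t 3) ^ κ 3 * t 3 ^ κ 4) := by
  obtain ⟨d, R, hR, hRP⟩ := exists_homogeneous_gaps P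
  refine ⟨d, R.support, fun κ => coeff κ R, fun κ hκ => ?_, fun t => ?_⟩
  · have h := hR (mem_support_iff.mp hκ)
    simpa [Finsupp.weight_apply, Finsupp.sum_fintype, Finsupp.degree] using h
  · rw [← hRP t, aeval_gaps_eq_sum]
    refine Finset.sum_congr rfl fun κ _ => ?_
    simp only [Fin.prod_univ_five, gaps_zero, gaps_one, gaps_two, gaps_three, gaps_four]

/-- **MATCH₄ (E) for a reduced datum**: dividing by the chord product `Q`, a reduced integrand `P/Q` is pointwise a ℚ-combination of
single 5-gap monomial classes `g^κ/Q` of one total degree (the `IsLayerFour` shapes, up to admissibility). -/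
theorem gapExpand_div (P : MvPolynomial (Fin 4) ℚ) (Q : (Fin 4 → ℝ) → ℝ) :
    ∃ (d : ℕ) (S : Finset (Fin 5 →₀ ℕ)) (c : (Fin 5 →₀ ℕ) → ℚ),
      (∀ κ ∈ S, ∑ i, κ i = d) ∧
      ∀ t : Fin 4 → ℝ, aeval t P / Q t =
        ∑ κ ∈ S, (c κ : ℝ) * ((1 - t 0) ^ κ 0 * (t 0 - t 1) ^ κ 1 * (t 1 - t 2) ^ κ 2 * (t 2 - t 3) ^ κ 3 * t 3 ^ κ 4) / Q t := by
  obtain ⟨d, S, c, hS, h⟩ := gapExpand P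
  refine ⟨d, S, c, hS, fun t => ?_⟩
  rw [h t, Finset.sum_div]

end Summit.KontsevichZagierPeriods.KontsevichZagierPeriods.Cruxes.GZNormalFormWThree.GZLadder.GapExpand
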